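import Literature.NumberTheory.EllipticCurves.CuspFormLFunction
import Literature.NumberTheory.EllipticCurves.Newforms
import HarnessLib

/-!
# `L`-series of newforms on `Γ₁(N)`: Euler product, coefficients at `p ∣ N`, and the
weight-one functional equation (Deligne–Serre 1974, §1.7–1.8 and §4 (b) (i))

This file vendors, as named facts `def X : Prop` (D-0014), the three analytic inputs about
the newform `f` in Deligne–Serre's proof of their Thm. 4.6 (*Formes modulaires de poids 1*,
Ann. Sci. ÉNS (4) 7 (1974), pp. 515–516) that the tree does not yet have; they are the
`f`-side leaves of the decomposition of `Literature.NumberTheory.Automorphic.artinConductorNat_eq_level` (top layer: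
`Literature.NumberTheory.Automorphic.LanglandsTunnellProofs`; Lemma 4.9:
`Literature.NumberTheory.LFunctions.FiniteEulerProducts`).  For a normalised newform
`f = Σ a_n qⁿ ∈ S_k(Γ₁(N))` ("forme parabolique primitive de type `(k, ε)` sur `Γ₀(N)`",
`ε = nebentypus f`):

* `IsNewform1.hasProd_cuspFormLSeries` — **(1.7.2)**: the Euler product
  `Φ_f(s) = Σ a_n n^{-s} = ∏_{p ∣ N} (1 - a_p p^{-s})⁻¹ ∏_{p ∤ N} (1 - a_p p^{-s} + ε(p) p^{k-1-2s})⁻¹`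
  (on `re s > k/2 + 1`, where the series converges absolutely by the trivial bound; the two
  kinds of factors are one formula since `ε(p) = 0` for `p ∣ N`).  The tree has the
  `Γ₀(N)` case only (`IsNewform0.hasProd_cuspFormLSeries`).
* `IsNewform1.cuspCoeff_of_dvd_level` — **1.8**: for `p ∣ N`, `a_p = 0` if `p² ∣ N` and `ε`
  is definable mod `N/p`; `|a_p| = p^{(k-1)/2}` if `ε` is not definable mod `N/p`;
  `|a_p| = p^{k/2-1}` if `p² ∤ N` and `ε` is definable mod `N/p` (Li 1975, Thm. 3; Ogg 1969),
  with the proved corollary `IsNewform1.norm_cuspCoeff_le_one_of_dvd_level`: in weight one,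
  `|a_p| ≤ 1` for `p ∣ N` — the form in which 1.8 enters the proof of Thm. 4.6 (iv).
* `DeligneSerre1974.weightOne_functionalEquation` — **§4 (b) (i)**: for `f` primitive of type
  `(1, ε)` there is `λ ≠ 0` with `f(-1/Nz) = λ z f̃(z)`, `f̃ = Σ ā_n qⁿ` (Li 1975; Miyake
  1971), whence by Mellin transform `Λ_f(1 - s) = a Λ_{f̃}(s)` with `a ≠ 0`, where
  `Λ_f(s) = N^{s/2} (2π)^{-s} Γ(s) Φ_f(s)` (`completedCuspFormL N f`) and `Λ_{f̃}` is the same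
  expression built on `Φ_{f̃}(s) = Σ ā_n n^{-s}` (`conjCuspFormLSeries`,
  `completedConjCuspFormL`); both extend to entire functions.

## Design notes

* All carriers are the tree's: `cuspCoeff`, `cuspFormLSeries`, `completedCuspFormL`
  (`Literature.NumberTheory.EllipticCurves.CuspFormLFunction`), `IsNewform1`, `nebentypus`
  (`…Newforms`), Mathlib `DirichletCharacter.FactorsThrough` ("`ε` peut être défini
  mod `N/p`"), `HasProd` over `Nat.Primes`, `LSeries`.
* The functional equation is stated through the conjugate-coefficient series rather than
  through the cusp form `f̃ = Σ ā_n qⁿ` itself (which the tree cannot yet name: no complex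
  conjugation of `q`-expansions), exactly as it is consumed in op. cit. (iii); the constant
  `a` is only asserted nonzero (its value `± i λ N^{1/2}`-type normalisation is not used).
* Half-plane `re s > k/2 + 1` (`= 3/2` in weight one) as in `completedCuspFormLContinuations`:
  the region of absolute convergence from the trivial bound `a_n = O(n^{k/2})`
  (`LSeriesSummable_cuspCoeff`), so no appeal to Cor. 4.2 (Ramanujan–Petersson in weight
  one) is hidden in the statements.

## References

* P. Deligne, J.-P. Serre, *Formes modulaires de poids 1*, Ann. Sci. ÉNS (4) 7 (1974),
  507–530 — 1.7, (1.7.2), 1.8, §4 (b) proof of Thm. 4.6, step (i) (`DeligneSerreASENS1974`).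
* W. Li, *Newforms and functional equations*, Math. Ann. 212 (1975), 285–315, Thm. 3
  (`Li1975`); T. Miyake, *On automorphic forms on GL₂ and Hecke operators*, Ann. of Math. 94
  (1971); A. Ogg, *On the eigenvalues of Hecke operators*, Math. Ann. 179 (1969) — the
  references [12], [13], [14] of Deligne–Serre for 1.7–1.8 and (i).
-/

noncomputable section

open scoped MatrixGroups ModularForm

open CongruenceSubgroup Complex

namespace Literature.NumberTheory.EllipticCurves.ModularForms

variable {N : ℕ} [NeZero N] {k : ℤ}

/-! ### (1.7.2): Euler product of a newform on `Γ₁(N)` -/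

/-- **Deligne–Serre 1974, (1.7.2)** (Euler product of a primitive form).  Let
`f = Σ a_n qⁿ ∈ S_k(Γ₁(N))` be a newform (normalised: `a_1 = 1`; eigenfunction of the `T_p`
and `U_p` with eigenvalues `a_p`) with nebentypus `ε`.  Then for `re s > k/2 + 1` the
Dirichlet series `Φ_f(s) = Σ a_n n^{-s}` (`cuspFormLSeries f`) has the Euler product
`Φ_f(s) = ∏_{p ∣ N} (1 - a_p p^{-s})⁻¹ ∏_{p ∤ N} (1 - a_p p^{-s} + ε(p) p^{k-1-2s})⁻¹`,
convergent as a product over the primes (`HasProd` over `Nat.Primes`); the two kinds of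
factors are written as one, `ε(p) = 0` for `p ∣ N` (`ε` a Dirichlet character mod `N`).
Ref: Deligne–Serre 1.7, (1.7.1)–(1.7.2), after Atkin–Lehner and Li, *Newforms and functional
equations*, Math. Ann. 212 (1975), Thm. 3.  The `Γ₀(N)` case is
`IsNewform0.hasProd_cuspFormLSeries`. [cite: DeligneSerreASENS1974, (1.7.2)] -/
def IsNewform1.hasProd_cuspFormLSeries : Prop :=
  ∀ {f : CuspForm (Gamma1 N) k} (_hf : IsNewform1 f) {s : ℂ} (_hs : (k : ℝ) / 2 + 1 < s.re),
    HasProd (fun p : Nat.Primes ↦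
      (1 - cuspCoeff f p * (p : ℂ) ^ (-s) +
        nebentypus f (p : ZMod N) * (p : ℂ) ^ ((k : ℂ) - 1 - 2 * s))⁻¹)
      (cuspFormLSeries f s)

/-! ### 1.8: the coefficients `a_p`, `p ∣ N` -/

/-- **Deligne–Serre 1974, 1.8** (absolute value of `a_p` for `p ∣ N`).  Let
`f = Σ a_n qⁿ ∈ S_k(Γ₁(N))` be a newform with nebentypus `ε`, and let `p` be a prime dividing
`N`.  Say that `ε` *is definable mod `N/p`* if it factors through `(ℤ/(N/p)ℤ)ˣ`
(Mathlib `DirichletCharacter.FactorsThrough`).  Then: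
`a_p = 0` if `p² ∣ N` and `ε` is definable mod `N/p`;
`|a_p| = p^{(k-1)/2}` if `ε` is not definable mod `N/p`;
`|a_p| = p^{k/2-1}` if `p² ∤ N` and `ε` is definable mod `N/p`.
Ref: Deligne–Serre 1.8, after Li, Math. Ann. 212 (1975), Thm. 3, and Ogg, Math. Ann. 179
(1969). [cite: DeligneSerreASENS1974, 1.8] -/
def IsNewform1.cuspCoeff_of_dvd_level : Prop :=
  ∀ {f : CuspForm (Gamma1 N) k} (_hf : IsNewform1 f) {p : ℕ} (_hp : p.Prime) (_hpN : p ∣ N),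
    (p ^ 2 ∣ N → (nebentypus f).FactorsThrough (N / p) → cuspCoeff f p = 0) ∧
      (¬(nebentypus f).FactorsThrough (N / p) →
        ‖cuspCoeff f p‖ = (p : ℝ) ^ (((k : ℝ) - 1) / 2)) ∧
      (¬p ^ 2 ∣ N → (nebentypus f).FactorsThrough (N / p) →
        ‖cuspCoeff f p‖ = (p : ℝ) ^ ((k : ℝ) / 2 - 1))

/-- **Weight one: `|a_p| ≤ 1` for `p ∣ N`** ("on peut invoquer 1.8 qui montre que
`|a_p| ≤ 1`", Deligne–Serre, proof of Thm. 4.6, (iv)), from 1.8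
(`IsNewform1.cuspCoeff_of_dvd_level`, threaded as a hypothesis, D-0014): in weight `k = 1`
the three cases give `a_p = 0`, `|a_p| = p⁰ = 1`, `|a_p| = p^{-1/2} ≤ 1`.
[cite: DeligneSerreASENS1974, §4 (b) proof of Thm. 4.6 (iv)] -/
theorem IsNewform1.norm_cuspCoeff_le_one_of_dvd_level
    (h18 : IsNewform1.cuspCoeff_of_dvd_level (N := N) (k := 1)) {f : CuspForm (Gamma1 N) 1}
    (hf : IsNewform1 f) {p : ℕ} (hp : p.Prime) (hpN : p ∣ N) : ‖cuspCoeff f p‖ ≤ 1 := by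
  obtain ⟨h0, h1, h2⟩ := h18 hf hp hpN
  by_cases hε : (nebentypus f).FactorsThrough (N / p)
  · by_cases hp2 : p ^ 2 ∣ N
    · rw [h0 hp2 hε, norm_zero]
      exact zero_le_one
    · rw [h2 hp2 hε]
      have hp1 : (1 : ℝ) ≤ p := by exact_mod_cast hp.one_lt.le
      calc (p : ℝ) ^ (((1 : ℤ) : ℝ) / 2 - 1) ≤ (p : ℝ) ^ (0 : ℝ) :=
            Real.rpow_le_rpow_of_exponent_le hp1 (by norm_num)
        _ = 1 := Real.rpow_zero _
  · rw [h1 hε]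
    norm_num

/-! ### §4 (b) (i): the weight-one functional equation `Λ_f(1 - s) = a Λ_{f̃}(s)` -/

section ConjSeries

variable {Γ : Subgroup (GL (Fin 2) ℝ)}

/-- The Dirichlet series `Φ_{f̃}(s) = Σ ā_n n^{-s}` with the complex-conjugate coefficients of
`f` (the `L`-series of `f̃ = Σ ā_n qⁿ`; Mathlib `LSeries`).
Ref: Deligne–Serre 1974, §4 (b) (i) ("`Φ_{f̃}(s)`"). [cite: DeligneSerreASENS1974, §4 (b) (i)] -/
def conjCuspFormLSeries (f : CuspForm Γ k) (s : ℂ) : ℂ :=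
  LSeries (fun n ↦ (starRingEnd ℂ) (cuspCoeff f n)) s

/-- `Λ_{f̃}(s) = N^{s/2} (2π)^{-s} Γ(s) Φ_{f̃}(s)`, the raw completed series of the conjugate
coefficients (same shape as `completedCuspFormL N f`; meaningful on the half-plane of
absolute convergence).  Ref: Deligne–Serre 1974, §4 (b) (i) ("`Λ_g(s) = N^{s/2} (2π)^{-s} Γ(s) Φ_g(s)`").
[cite: DeligneSerreASENS1974, §4 (b) (i)] -/
def completedConjCuspFormL (N : ℕ) (f : CuspForm Γ k) (s : ℂ) : ℂ :=
  (N : ℂ) ^ (s / 2) * (2 * Real.pi : ℂ) ^ (-s) * Complex.Gamma s * conjCuspFormLSeries f s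

/-- Unfolding lemma: `Φ_{f̃}` is the `LSeries` of `n ↦ conj (a_n)`. [folklore] -/
theorem conjCuspFormLSeries_def (f : CuspForm Γ k) (s : ℂ) :
    conjCuspFormLSeries f s = LSeries (fun n ↦ (starRingEnd ℂ) (cuspCoeff f n)) s :=
  rfl

/-- The conjugate-coefficient series converges absolutely where `Φ_f` does by the trivial
bound `a_n = O(n^{k/2})` (Mathlib `CuspFormClass.qExpansion_isBigO`): for `re s > k/2 + 1`
on a level whose cusp at `∞` has width `1` (`|ā_n| = |a_n|`). [folklore] -/
theorem LSeriesSummable_conj_cuspCoeff [Γ.IsArithmetic] (hΓ : Γ.strictWidthInfty = 1)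
    (f : CuspForm Γ k) {s : ℂ} (hs : (k : ℝ) / 2 + 1 < s.re) :
    LSeriesSummable (fun n ↦ (starRingEnd ℂ) (cuspCoeff f n)) s := by
  refine LSeriesSummable_of_isBigO_rpow hs (Asymptotics.IsBigO.of_norm_left ?_)
  have h := (CuspFormClass.qExpansion_isBigO f).norm_left
  rw [hΓ] at h
  simp_rw [Complex.norm_conj]
  rw [add_sub_cancel_right]
  exact h

/-- The set of **entire continuations of `Λ_{f̃}`**: entire functions agreeing with the raw
product `completedConjCuspFormL N f` on `re s > k/2 + 1` (at most one element, by the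
identity theorem; companion of `completedCuspFormLContinuations N f`). [folklore] -/
def completedConjCuspFormLContinuations (N : ℕ) (f : CuspForm Γ k) : Set (ℂ → ℂ) :=
  {Λ | Differentiable ℂ Λ ∧ ∀ s : ℂ, (k : ℝ) / 2 + 1 < s.re → Λ s = completedConjCuspFormL N f s}

end ConjSeries

namespace DeligneSerre1974

/-- **Deligne–Serre 1974, §4 (b), proof of Thm. 4.6, step (i)** (functional equation in
weight one).  Let `f = Σ a_n qⁿ ∈ S₁(Γ₁(N))` be a newform ("parabolique primitive de type
`(1, ε)`").  "Du fait que `f` est primitive, il existe une constante `λ ≠ 0` telle que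
`f(-1/Nz) = λ z f̃(z)`" (`f̃ = Σ ā_n qⁿ`; Li 1975, Miyake 1971), and by Mellin transform
`Λ_f(1 - s) = a Λ_{f̃}(s)` with `a ≠ 0`, where `Λ_g(s) = N^{s/2} (2π)^{-s} Γ(s) Φ_g(s)`.
Formalised with the entire continuations of the raw products `completedCuspFormL N f`
(`Λ_f`) and `completedConjCuspFormL N f` (`Λ_{f̃}`, built on `Φ_{f̃}(s) = Σ ā_n n^{-s}`) from
the half-plane `re s > 3/2` of absolute convergence; both continuations exist (cusp forms)
and are unique.  Ref: op. cit. p. 515, (i), citing [12] W. Li, *Newforms and functional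
equations*, Math. Ann. 212 (1975) and [13] T. Miyake, Ann. of Math. 94 (1971).
[cite: DeligneSerreASENS1974, §4 (b) proof of Thm. 4.6 (i)] -/
def weightOne_functionalEquation : Prop :=
  ∀ {f : CuspForm (Gamma1 N) 1} (_hf : IsNewform1 f),
    ∃ a : ℂ, a ≠ 0 ∧ ∃ Λ ∈ completedCuspFormLContinuations N f,
      ∃ Λ' ∈ completedConjCuspFormLContinuations N f, ∀ s : ℂ, Λ (1 - s) = a * Λ' s

end DeligneSerre1974


end Literature.NumberTheory.EllipticCurves.ModularForms
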